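import Literature.AlgebraicGeometry.Resolution.AlterationsLemma411Vertex
import HarnessLib

/-!
# The vertex `(0 : … : 0 : 1)` of `ℙ^{d+1}_k` is a closed point; the punctured space

Topic: `Literature/AlgebraicGeometry/Resolution`. First PROVED layer under
`AlterationsLemma411Vertex.lean` (the decomposition of de Jong 1996, proof of Lemma 4.11,
normalised at the vertex `p = (0 : … : 0 : 1) = V₊(x₀, …, x_d) ∈ ℙ^{d+1}_k`,
`DeJong1996.vertex d k`): elementary facts about the vertex needed by both named facts of that
file — `DeJong1996.PointBlowupProjection` asks for `p` to be a closed point, and the linear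
projection `pr_p` from the vertex lives on `ℙ^{d+1} ∖ {p}`, which must be an open subscheme
covered by the charts `D₊(x_i)`, `i ≤ d`, on which `pr_p` was defined chart by chart
(`DeJong1996.vertexProjectionChart`).

* `DeJong1996.sub_C_mul_X_pow_mem_vertexIdeal` — a homogeneous `g` of degree `n` is
  `c · x_{d+1}^n` modulo `(x₀, …, x_d)`, `c` its coefficient at `x_{d+1}^n`.
* `DeJong1996.eq_vertex_of_vertexIdeal_le` — **maximality**: a point of `ℙ^{d+1}_k` (a relevant
  homogeneous prime) containing `x₀, …, x_d` is the vertex: it cannot contain a power of `x_{d+1}`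
  (it would then contain the irrelevant ideal), so every homogeneous member has `c = 0`.
* `DeJong1996.isClosed_singleton_vertex` — **the vertex is a closed point** (the closure of a
  point of `Proj` consists of the points containing its prime, Mathlib
  `ProjectiveSpectrum.le_iff_mem_closure`).
* `DeJong1996.puncturedSpace d k` — the open `⋃_{i ≤ d} D₊(x_i)` of `ℙ^{d+1}_k`, and
  `DeJong1996.mem_puncturedSpace_iff` / `coe_puncturedSpace`: **it is exactly
  `ℙ^{d+1} ∖ {vertex}`** (a point other than the vertex misses one of `x₀, …, x_d`).

As in `AlterationsLemma411Vertex.lean`, `ℙ^{d+1}_k` is written in the `Proj k[x₀, …, x_{d+1}]`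
spelling, to which `(projectiveSpace (d + 1) k).left` reduces by `rfl`. All statements are
[folklore] (Hartshorne II Ex. 2.14, Ex. 3.12: points and closed subsets of `Proj`).

## Sources

* R. Hartshorne, *Algebraic Geometry* (1977), II Prop. 2.5 and Ex. 2.14 (the topology of `Proj`).
  [Hartshorne1977]
* A. J. de Jong, *Smoothness, semi-stability and alterations* (1996), proof of Lemma 4.11,
  p. 68 (the role of `p` and of `ℙ^d ∖ {p}`). [DeJong1996]
-/

noncomputable section

open CategoryTheory CategoryTheory.Limits AlgebraicGeometry TopologicalSpace HomogeneousLocalization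

attribute [local instance] MvPolynomial.gradedAlgebra

namespace Literature.AlgebraicGeometry.Resolution

universe u

open Literature.AlgebraicGeometry.Motives (projectiveSpace)
open Literature.AlgebraicGeometry.Motives.Segre (grading X_mem)

namespace DeJong1996

variable (d : ℕ) (k : Type u) [Field k]

open _root_.MvPolynomial in
/-- A homogeneous `g ∈ k[x₀, …, x_{d+1}]` of degree `n` is congruent to `c · x_{d+1}^n` modulo
`(x₀, …, x_d)`, `c` being its coefficient at `x_{d+1}^n`: every other monomial of degree `n`
involves one of `x₀, …, x_d`. [folklore] -/
theorem sub_C_mul_X_pow_mem_vertexIdeal {n : ℕ} {g : MvPolynomial (Fin (d + 1 + 1)) k}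
    (hg : g ∈ grading (Fin (d + 1 + 1)) k n) :
    g - C (coeff (Finsupp.single (Fin.last (d + 1)) n) g) * X (Fin.last (d + 1)) ^ n ∈
      (vertexIdeal d k).toIdeal := by
  classical
  rw [toIdeal_vertexIdeal, mem_ideal_span_X_image]
  intro m hm
  rw [mem_support_iff, coeff_sub, coeff_C_mul, coeff_X_pow] at hm
  by_cases hms : Finsupp.single (Fin.last (d + 1)) n = m
  · subst hms
    simp at hm
  · rw [if_neg hms, mul_zero, sub_zero] at hm
    -- `m` is a monomial of `g`, of degree `n`, different from `x_{d+1}^n`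
    have hdeg : Finsupp.weight (1 : Fin (d + 1 + 1) → ℕ) m = n := hg hm
    by_contra h
    push Not at h
    have hsupp : m.support ⊆ {Fin.last (d + 1)} := by
      intro i hi
      rw [Finset.mem_singleton]
      rcases Fin.eq_castSucc_or_eq_last i with ⟨j, rfl⟩ | rfl
      · exact absurd (h _ ⟨j, rfl⟩) (Finsupp.mem_support_iff.1 hi)
      · rfl
    obtain ⟨b, hb⟩ := Finsupp.support_subset_singleton'.1 hsupp
    rw [hb, Finsupp.weight_single, smul_eq_mul, Pi.one_apply, mul_one] at hdeg
    subst hdeg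
    exact hms hb.symm

open _root_.MvPolynomial in
/-- **The homogeneous prime `(x₀, …, x_d)` is maximal among the points of `ℙ^{d+1}_k`**: a
relevant homogeneous prime containing `x₀, …, x_d` contains no power of `x_{d+1}` (else it
would contain the irrelevant ideal), hence, being homogeneous, is `(x₀, …, x_d)`. [folklore] -/
theorem eq_vertex_of_vertexIdeal_le (x : Proj (grading (Fin (d + 1 + 1)) k))
    (hx : vertexIdeal d k ≤ x.asHomogeneousIdeal) : x = vertex d k := by
  classical
  have hx' : (vertexIdeal d k).toIdeal ≤ x.asHomogeneousIdeal.toIdeal := hx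
  -- `x_{d+1} ∉ 𝔮`
  have hlast : (X (Fin.last (d + 1)) : MvPolynomial (Fin (d + 1 + 1)) k) ∉
      x.asHomogeneousIdeal.toIdeal := by
    intro h
    refine x.not_irrelevant_le fun p hp => ?_
    have hp' := Literature.AlgebraicGeometry.Motives.Segre.irrelevant_le_span_X
      (Fin (d + 1 + 1)) k hp
    refine (Ideal.span_le.2 ?_) hp'
    rintro _ ⟨i, rfl⟩
    rcases Fin.eq_castSucc_or_eq_last i with ⟨j, rfl⟩ | rfl
    · exact hx' (X_castSucc_mem_vertexIdeal d k j)
    · exact h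
  -- `𝔮 ≤ (x₀, …, x_d)`, component by component
  have hle : x.asHomogeneousIdeal.toIdeal ≤ (vertexIdeal d k).toIdeal := by
    intro f hf
    rw [← DirectSum.sum_support_decompose (grading (Fin (d + 1 + 1)) k) f]
    refine Ideal.sum_mem _ fun n _ => ?_
    have hgq : (DirectSum.decompose (grading (Fin (d + 1 + 1)) k) f n : MvPolynomial _ k) ∈
        x.asHomogeneousIdeal.toIdeal :=
      (x.asHomogeneousIdeal.isHomogeneous.mem_iff.1 hf) n
    have hsub := sub_C_mul_X_pow_mem_vertexIdeal d k
      (SetLike.coe_mem (DirectSum.decompose (grading (Fin (d + 1 + 1)) k) f n))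
    set g : MvPolynomial (Fin (d + 1 + 1)) k :=
      ((DirectSum.decompose (grading (Fin (d + 1 + 1)) k) f n : grading (Fin (d + 1 + 1)) k n) :
        MvPolynomial (Fin (d + 1 + 1)) k)
    set c := coeff (Finsupp.single (Fin.last (d + 1)) n) g
    by_cases hc : c = 0
    · simpa [hc] using hsub
    · exfalso
      apply hlast
      have h1 : C c * X (Fin.last (d + 1)) ^ n ∈ x.asHomogeneousIdeal.toIdeal := by
        have := Ideal.sub_mem _ hgq (hx' hsub)
        rwa [sub_sub_cancel] at this
      have h2 : X (Fin.last (d + 1)) ^ n ∈ x.asHomogeneousIdeal.toIdeal := by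
        have := Ideal.mul_mem_left _ (C c⁻¹) h1
        rwa [← mul_assoc, ← C_mul, inv_mul_cancel₀ hc, C_1, one_mul] at this
      exact x.isPrime.mem_of_pow_mem n h2
  exact ProjectiveSpectrum.ext (le_antisymm hle hx)

/-- **The vertex is a closed point of `ℙ^{d+1}_k`.** [folklore] -/
theorem isClosed_singleton_vertex :
    IsClosed ({vertex d k} : Set (Proj (grading (Fin (d + 1 + 1)) k))) := by
  refine isClosed_of_closure_subset fun y hy => ?_
  rw [Set.mem_singleton_iff]
  exact eq_vertex_of_vertexIdeal_le d k y
    ((ProjectiveSpectrum.le_iff_mem_closure (x := vertex d k) (y := y)).2 hy)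

/-- **The punctured projective space `ℙ^{d+1}_k ∖ {vertex}`** as the open
`⋃_{i ≤ d} D₊(x_i)` — the domain of the linear projection from the vertex. [folklore] -/
def puncturedSpace : (Proj (grading (Fin (d + 1 + 1)) k)).Opens :=
  ⨆ i : Fin (d + 1), Proj.basicOpen (grading (Fin (d + 1 + 1)) k) (MvPolynomial.X (Fin.castSucc i))

/-- The charts `D₊(x_i)`, `i ≤ d`, lie in the punctured space. [folklore] -/
theorem basicOpen_le_puncturedSpace (i : Fin (d + 1)) :
    Proj.basicOpen (grading (Fin (d + 1 + 1)) k) (MvPolynomial.X (Fin.castSucc i)) ≤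
      puncturedSpace d k :=
  le_iSup (fun i : Fin (d + 1) =>
    Proj.basicOpen (grading (Fin (d + 1 + 1)) k) (MvPolynomial.X (Fin.castSucc i))) i

/-- **`ℙ^{d+1} ∖ {vertex} = ⋃_{i ≤ d} D₊(x_i)`**: a point other than the vertex misses one of
`x₀, …, x_d` (maximality of `(x₀, …, x_d)`, `eq_vertex_of_vertexIdeal_le`). [folklore] -/
theorem mem_puncturedSpace_iff (x : Proj (grading (Fin (d + 1 + 1)) k)) :
    x ∈ puncturedSpace d k ↔ x ≠ vertex d k := by
  rw [puncturedSpace, Opens.mem_iSup]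
  constructor
  · rintro ⟨i, hi⟩ rfl
    exact vertex_notMem_basicOpen d k i hi
  · intro hx
    by_contra h
    push Not at h
    refine hx (eq_vertex_of_vertexIdeal_le d k x ?_)
    change (vertexIdeal d k).toIdeal ≤ x.asHomogeneousIdeal.toIdeal
    rw [toIdeal_vertexIdeal, Ideal.span_le]
    rintro _ ⟨_, ⟨i, rfl⟩, rfl⟩
    by_contra hni
    exact h i ((Proj.mem_basicOpen _ _ _).2 hni)

/-- The punctured space is the complement of the vertex. [folklore] -/
theorem coe_puncturedSpace :
    (puncturedSpace d k : Set (Proj (grading (Fin (d + 1 + 1)) k))) = {vertex d k}ᶜ :=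
  Set.ext fun x => mem_puncturedSpace_iff d k x

end DeJong1996

end Literature.AlgebraicGeometry.Resolution

end
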